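import Summits.ResolutionOfSingularities.ResolutionOfSingularities.Theorems.HilbertSamuelEliminationSigmaMaxModificationsCorridor3WLadderHybridLowCycles
import Summits.ResolutionOfSingularities.ResolutionOfSingularities.Theorems.HilbertSamuelEliminationSigmaMaxModificationsCorridor3WLadderHybridLowCleanDefs
import Summits.ResolutionOfSingularities.ResolutionOfSingularities.Theorems.HilbertSamuelEliminationSigmaMaxModificationsCorridor3WLadderHybridLowPlug
import HarnessLib

/-!
# [OURS · L1 W4.2] `Corridor3WLadderHybridLowRegular` — THE (c-reg) SUPPLIER of the strategy-generic LOW ADAPTER: for the menu hybrid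
# `π.hybrid (ofStageOracleE ω)` with ATOMIC fallback cycles, (K-ctr)From ∧ (π-fin)From ⇒ (c-reg)From «at late states between cycles the reduced
# treated part is regular at the chain point»; hence E7's Low class at a maximal origin from (b), (K-ctr), (π-fin), (c-menu) and the units half

Crux chain w42 (`SigmaMaxModifications`, stmt-ResolutionOfSingularities-18506; conjunct `SigmaMaxModificationsCorridor3`,
stmt-ResolutionOfSingularities-19249), res-L1-w42-plan-1 RULINGS v3.14-21 (FS), v3.14-22 (FW), v3.14-35 (HR) «§3 ORDER: (c-rep) → (c-reg) → (b) → Seg-E»,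
v3.14-36. Typer res-type-040 (gen 19). PROOF FILE (no definitions). OURS (cell res-hironaka, slot W4.2); NOT statements of H. Hironaka's manuscript
[Hironaka2017] nor of [CossartJannsenSaito2020]; AI-typed, weaker than expert review. Helper file `--supports stmt-ResolutionOfSingularities-19249 --as
helper` (counted 0).

THE COUNT (port of stub-4's `Moving.strataCycleStartRegular_of_clean`, p518664, to hybrid σE-chains). Hypotheses on the hybrid `σ_h = π.hybrid τ`,
`τ = ofStageOracleE ω`: `π`, `ω` functional; POLICY STEPS EMIT `P' = none` ((FW) β, `hπnone`) and ARE SILENT WHILE A CYCLE IS PENDING (cycle atomicity,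
res-L1-type-o1 15:21:10Z `StrategyE.betweenCycles`: `hπgate`); every state σ_h-reached from `s₀` is RunGood (`RunGood k N ν`) and every step there has a
permissible centre; labels `≤` year at `s₀`, `s₀.pt ∈ X(ν)`. Along a moving never-isolated `G`-chain from a σ_h-reached start, past the stages given
by (K-ctr)From and (π-fin)From: (i) a clean label `j ≤ year` stays clean and the new label is clean (`LabelCleanAt.persist_σE`,
`labelCleanAt_birth_σE`, p544207), so LATE-BORN labels are clean for ever; (ii) a fallback step from a state with treated label `j` is continued BY
THE FALLBACK (`hπgate`) through the replay of the finite lower-dimensional sequence to the END step, whose centre is the part `Y_e^{(j)}`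
(`IsCanonicalStepΩE.support_eq_part_of_none`, `…HybridLowCycles`), after which `j` is clean (`labelCleanAt_reset_of_support_eq`) for ever; (iii) if NO late fallback
step treats the old label `j`, the late states between cycles with treated label `j` form a block of consecutive POLICY steps (the least non-empty
label does not decrease, `treatedLabel_le_of_step_hybrid`), which is finite because late policy centres miss `x_n` ((π-fin)From) while the chain
moves. So every old label has a bound past which the between-cycle states treating it are clean; finitely many old labels; a clean treated label
gives a treated part regular over the chain point (`LabelCleanAt.mem_regularLocus`, p518012).

* §2 **`strataCycleStartRegularFromσE_hybrid_of_clean`**: (K-ctr)From_h → (π-fin)From_h → `StrataCycleStartRegularFromσE σ_h N ν s₀ G` (the hybrid cycle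
  bookkeeping — `labelInv_of_reachesσE_hybrid`, `treatedLabel_le_of_step_hybrid`, `treatedLabel_eq_of_cycle_hybrid`, `step_fallback_of_pending`,
  `IsCanonicalStepΩE.support_eq_part_of_none` — is `…WLadderHybridLowCycles`).
* §3 by name: `low_init_hybrid_of_kernels` — E7's Low class at a maximal origin from (b)From, (K-ctr)From, (π-fin)From, (c-menu)From and the units
  half (through p537833 `strataReplaySettleFromσE_hybrid_of_cycleStartRegular` and p535770 `low_init_hybrid_of_rows`), and the `Q`-origin form
  `maxOriginNoMovingNearChainAtQσE_low_hybrid_of_kernels` (E7's `hlow` input shape, through p536342).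

References: CJS LNM 2270 Rem. 6.29 (1) pp. 91–92, p. 102 [CossartJannsenSaito2020]; tree `…WLadderStrataCycleStart` (stub-4's count),
`…WLadderStrataClean` (`LabelCleanAt.mem_regularLocus`), `…WLadderHybridLowStrict` (p544207), `…WLadderHybridLowCleanDefs` (p543924),
`…WLadderHybridLowReplay` (p537833), `…WLadderHybridLowSwallow` (p535770), `…WLadderHybridLowPlug` (p536342), `…WLadderHybridLowCycles`.
-/

noncomputable section

set_option linter.dupNamespace false

open CategoryTheory AlgebraicGeometry TopologicalSpace Topology
open Summit.ResolutionOfSingularities.ResolutionOfSingularities.Theorems.CampaignW42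
open Literature.AlgebraicGeometry.Resolution Literature.RingTheory.HilbertSamuel
open Literature.AlgebraicGeometry.CossartJannsenSaito2020
open Summit.ResolutionOfSingularities.ResolutionOfSingularities.Theorems.SigmaMaxModificationsCorridor3
open Summit.ResolutionOfSingularities.ResolutionOfSingularities.Theorems.SigmaMaxModificationsCorridor3.Moving

namespace Summit.ResolutionOfSingularities.ResolutionOfSingularities.Theorems.SigmaMaxModificationsCorridor3.Sigma

universe u

variable {π : StrategyE.{u}} {ω : StageOracleE.{u}} {N : ℕ} {ν : ℕ → ℕ}

/-! ## §2. (c-reg)From for the hybrid from (K-ctr)From and (π-fin)From -/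

/-- **THE (c-reg) SUPPLIER — PROVED: `StrataCycleStartRegularFromσE (π.hybrid (ofStageOracleE ω)) N ν s₀ G` FROM (K-ctr)From AND (π-fin)From**, for
π, ω functional, policy steps emitting `none` and silent while a cycle is pending (cycle atomicity), on the scope «every state reached from `s₀` is
RunGood and every step there has a permissible centre», the label invariant at `s₀`, `s₀.pt ∈ X(ν)`. The count of the module docstring.
[cite: CossartJannsenSaito2020, Rem. 6.29 (1), p. 102] -/
theorem strataCycleStartRegularFromσE_hybrid_of_clean {k : Type u} [Field k] {s₀ : MarkedStageE.{u}} {G : MarkedStage.{u} → Prop}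
    (hπ : π.IsFunctional N ν) (hω : OracleFunctionalΩE ω)
    (hπnone : ∀ (W : Scheme.{u}) (hW : IsLocallyNoetherian W) (L : Labelling W) (P : Option (Pending W)) (E : Boundary W)
      (C : W.IdealSheafData) (P' : Option (Pending (blowup C))), π.step W hW N ν L P E C P' → P' = none)
    (hπgate : ∀ (W : Scheme.{u}) (hW : IsLocallyNoetherian W) (L : Labelling W) (P : Option (Pending W)) (E : Boundary W)
      (C : W.IdealSheafData) (P' : Option (Pending (blowup C))), π.step W hW N ν L P E C P' → P = none)
    (hgood : ∀ s, ReachesσE (π.hybrid (StrategyE.ofStageOracleE ω)) N ν s₀ s → RunGood k N ν s.W)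
    (hperm : ∀ s, ReachesσE (π.hybrid (StrategyE.ofStageOracleE ω)) N ν s₀ s → ∀ (C : s.W.IdealSheafData) (P' : Option (Pending (blowup C))),
      (π.hybrid (StrategyE.ofStageOracleE ω)).step s.W s.ln N ν s.L s.P s.E C P' → IdealSheafData.IsPermissible C)
    (hinv₀ : LabelInv N ν s₀.toMarkedStage) (hpt₀ : s₀.pt ∈ Scheme.hsStratum s₀.W N ν)
    (hK : StrataCentreMembersCleanFromσE (π.hybrid (StrategyE.ofStageOracleE ω)) N ν s₀ G)
    (hfin : StrataPolicyMissesFromσE π (π.hybrid (StrategyE.ofStageOracleE ω)) N ν s₀ G) :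
    StrataCycleStartRegularFromσE (π.hybrid (StrategyE.ofStageOracleE ω)) N ν s₀ G := by
  have hfun : (π.hybrid (StrategyE.ofStageOracleE ω)).IsFunctional N ν := hπ.hybrid (StrategyE.isFunctional_ofStageOracleE hω N ν)
  intro c h0 hstep hG hnI hmov
  obtain ⟨n₁, hn₁⟩ := hK c h0 hstep hG hnI hmov
  obtain ⟨n₂, hn₂⟩ := hfin c h0 hstep hG hnI hmov
  have hreach : ∀ n, ReachesσE (π.hybrid (StrategyE.ofStageOracleE ω)) N ν s₀ (c n) := reachesσE_chain h0 hstep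
  have hgd : ∀ n, RunGood k N ν (c n).W := fun n => hgood _ (hreach n)
  have hinv : ∀ n, LabelInv N ν (c n).toMarkedStage := fun n => labelInv_of_reachesσE_hybrid hπnone hinv₀ hpt₀ (hreach n)
  have hlab : ∀ n Z, (c n).L.label Z ≤ (c n).L.year := fun n => (hinv n).label_le_year
  have hpt : ∀ n, (c n).pt ∈ Scheme.hsStratum (c n).W N ν := fun n => pt_mem_hsStratum_of_reachesσE (hreach n) hpt₀
  have hne : ∀ n, (Scheme.hsStratum (c n).W N ν).Nonempty := fun n => ⟨_, hpt n⟩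
  have htly : ∀ n, treatedLabel N ν (c n).toMarkedStage ≤ (c n).L.year := fun n => treatedLabel_le_year (hinv n) (hne n)
  have hmono : ∀ n d, treatedLabel N ν (c n).toMarkedStage ≤ treatedLabel N ν (c (n + d)).toMarkedStage := by
    intro n d
    induction d with
    | zero => exact le_rfl
    | succ d ih => exact ih.trans (treatedLabel_le_of_step_hybrid hπnone (hinv _) (hstep (n + d)) (hne _) (hne _))
  have hyear : ∀ n, (c n).L.year = (c 0).L.year + n := by
    intro n
    induction n with
    | zero => rfl
    | succ n ih => rw [(hstep n).year_eq, ih]; omega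
  choose f hf using fun n => (hstep n).exists_stepProjectionσE
  -- «the policy speaks at `n`» / «the step at `n` is a fallback step»
  let SP : ℕ → Prop := fun n =>
    ∃ (C₀ : (c n).W.IdealSheafData) (P₀ : Option (Pending (blowup C₀))), π.step (c n).W (c n).ln N ν (c n).L (c n).P (c n).E C₀ P₀
  let FB : ℕ → Prop := fun n => ∀ (C : (c n).W.IdealSheafData) (P' : Option (Pending (blowup C))),
    (π.hybrid (StrategyE.ofStageOracleE ω)).step (c n).W (c n).ln N ν (c n).L (c n).P (c n).E C P' →
      IsCanonicalStepΩE ω (c n).ln N ν (c n).L (c n).E (c n).P C P'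
  have hπstep : ∀ n, SP n → ∀ (C : (c n).W.IdealSheafData) (P' : Option (Pending (blowup C))),
      (π.hybrid (StrategyE.ofStageOracleE ω)).step (c n).W (c n).ln N ν (c n).L (c n).P (c n).E C P' →
        π.step (c n).W (c n).ln N ν (c n).L (c n).P (c n).E C P' := by
    intro n hsp C P' hcs
    rcases (show π.step (c n).W (c n).ln N ν (c n).L (c n).P (c n).E C P' ∨
        ((¬ ∃ (C₀ : (c n).W.IdealSheafData) (P₀ : Option (Pending (blowup C₀))),
            π.step (c n).W (c n).ln N ν (c n).L (c n).P (c n).E C₀ P₀) ∧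
          (StrategyE.ofStageOracleE ω).step (c n).W (c n).ln N ν (c n).L (c n).P (c n).E C P') from hcs) with hπs | ⟨hno, -⟩
    · exact hπs
    · exact absurd hsp hno
  have hdich : ∀ n, SP n ∨ FB n := by
    intro n
    by_cases hsp : SP n
    · exact Or.inl hsp
    · refine Or.inr fun C P' hcs => ?_
      rcases StrategyE.hybrid_step_cases hcs with hπs | hτs
      · exact absurd ⟨C, P', hπs⟩ hsp
      · exact hτs
  have hSPnone : ∀ n, SP n → (c (n + 1)).P = none := by
    intro n hsp
    obtain ⟨C, P', hln, x', hcs, -, -, -, hc⟩ := hstep n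
    rw [hc]
    exact hπnone _ _ _ _ _ _ _ (hπstep n hsp C P' hcs)
  have hSPmiss : ∀ n, n₂ ≤ n → SP n → ¬ (c n).IsBlownUpσE (π.hybrid (StrategyE.ofStageOracleE ω)) N ν := by
    rintro n hn hsp ⟨C, P', hcs, hxC⟩
    exact hn₂ n hn C P' (hπstep n hsp C P' hcs) hxC
  -- the one-step lemmas along the late part of the chain
  set m₀ := max n₁ n₂ with hm₀
  have hpersist : ∀ n, m₀ ≤ n → ∀ j, j ≤ (c n).L.year → LabelCleanAt N ν (c n).toMarkedStage j →
      LabelCleanAt N ν (c (n + 1)).toMarkedStage j := by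
    intro n hn j hj hclean
    obtain ⟨C, P', hln, x', hcs, -, -, -, -⟩ := hstep n
    exact LabelCleanAt.persist_σE hfun (hf n) (hgd n) (hgd (n + 1)) hcs
      (fun hxC => hn₁ n (le_of_max_le_left hn) C P' hcs hxC (f n) (hf n)) hj hclean
  have hbirth : ∀ n, m₀ ≤ n → LabelCleanAt N ν (c (n + 1)).toMarkedStage ((c n).L.year + 1) := by
    intro n hn
    obtain ⟨C, P', hln, x', hcs, -, -, -, -⟩ := hstep n
    exact labelCleanAt_birth_σE hfun (hf n) (hgd n) (hgd (n + 1)) hcs (hperm _ (hreach n) C P' hcs) (hlab n)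
      (fun hxC => hn₁ n (le_of_max_le_left hn) C P' hcs hxC (f n) (hf n))
  have hreset : ∀ n, m₀ ≤ n → (c (n + 1)).P = none → FB n →
      LabelCleanAt N ν (c (n + 1)).toMarkedStage (treatedLabel N ν (c n).toMarkedStage) := by
    intro n hn hnone hτ
    obtain ⟨C, P', hln, x', hcs, -, -, -, hc⟩ := hstep n
    have hP' : P' = none := by rw [hc] at hnone; exact hnone
    exact labelCleanAt_reset_of_support_eq (hf n) ((hτ C P' hcs).support_eq_part_of_none hP') (htly n)
      (fun hxC => hn₁ n (le_of_max_le_left hn) C P' hcs hxC (f n) (hf n))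
  -- persistence for ever
  have hpersist' : ∀ n, m₀ ≤ n → ∀ j, j ≤ (c n).L.year → LabelCleanAt N ν (c n).toMarkedStage j →
      ∀ d, LabelCleanAt N ν (c (n + d)).toMarkedStage j := by
    intro n hn j hj hclean d
    induction d with
    | zero => exact hclean
    | succ d ih =>
      rw [← add_assoc]
      exact hpersist (n + d) (by omega) j (by rw [hyear] at hj ⊢; omega) ih
  -- late-born labels are clean from birth on
  have hnew : ∀ d j, (c m₀).L.year < j → LabelCleanAt N ν (c (m₀ + d)).toMarkedStage j := by
    intro d
    induction d with
    | zero =>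
      intro j hj
      change LabelCleanAt N ν (c m₀).toMarkedStage j
      exact labelCleanAt_of_forall_ne fun Z _ hl => by have := hlab m₀ Z; omega
    | succ d ih =>
      intro j hj
      rcases Nat.lt_trichotomy j ((c (m₀ + d)).L.year + 1) with hlt | heq | hgt
      · rw [← add_assoc]
        exact hpersist (m₀ + d) (by omega) j (by omega) (ih j hj)
      · rw [← add_assoc, heq]
        exact hbirth (m₀ + d) (by omega)
      · rw [← add_assoc]
        exact labelCleanAt_of_forall_ne fun Z _ hl => by
          have := hlab (m₀ + d + 1) Z; rw [(hstep (m₀ + d)).year_eq] at this; omega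
  -- every label has a bound past which its between-cycle states are clean
  have hb : ∀ j, ∃ b, ∀ r, b ≤ r → (c r).P = none → treatedLabel N ν (c r).toMarkedStage = j →
      LabelCleanAt N ν (c r).toMarkedStage j := by
    intro j
    by_cases hjY : (c m₀).L.year < j
    · refine ⟨m₀, fun r hr _ _ => ?_⟩
      obtain ⟨d, rfl⟩ := Nat.exists_eq_add_of_le hr
      exact hnew d j hjY
    by_cases hex : ∃ n, m₀ ≤ n ∧ FB n ∧ treatedLabel N ν (c n).toMarkedStage = j
    · -- (A) a late FALLBACK step treats `j`: its cycle runs to the END `e` (atomicity), after which `j` is clean for ever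
      obtain ⟨n, hn, hFB, htn⟩ := hex
      obtain ⟨e, he, hPe, hmin⟩ : ∃ e, n ≤ e ∧ (c (e + 1)).P = none ∧ ∀ m, n ≤ m → m < e → (c (m + 1)).P ≠ none := by
        classical
        have hend : ∃ m, n ≤ m ∧ (c (m + 1)).P = none := by
          obtain ⟨m, hm, hP⟩ := exists_next_none_hybrid (ω := ω) hπnone hstep (n + 1)
          exact ⟨m - 1, by omega, by rwa [show m - 1 + 1 = m by omega]⟩
        exact ⟨Nat.find hend, (Nat.find_spec hend).1, (Nat.find_spec hend).2, fun m hm hme hP => Nat.find_min hend hme ⟨hm, hP⟩⟩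
      have hte : treatedLabel N ν (c e).toMarkedStage = j := (treatedLabel_eq_of_cycle_hybrid hπnone hstep he hmin).trans htn
      have hFBe : FB e := by
        rcases Nat.eq_or_lt_of_le he with heq | hlt
        · subst heq; exact hFB
        · have hPe' : (c e).P ≠ none := by
            have := hmin (e - 1) (by omega) (by omega)
            rwa [show e - 1 + 1 = e by omega] at this
          exact fun C P' hcs => step_fallback_of_pending hπgate hPe' hcs
      have hclean : LabelCleanAt N ν (c (e + 1)).toMarkedStage j := hte ▸ hreset e (hn.trans he) hPe hFBe
      have hjy : j ≤ (c (e + 1)).L.year := by rw [← hte, (hstep e).year_eq]; exact (htly e).trans (Nat.le_succ _)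
      refine ⟨e + 1, fun r hr _ _ => ?_⟩
      obtain ⟨d, rfl⟩ := Nat.exists_eq_add_of_le hr
      exact hpersist' (e + 1) (by omega) j hjy hclean d
    · -- (B) no late fallback step treats `j`: the late between-cycle states treating `j` are finitely many (a block of policy steps otherwise)
      suffices hB : ∃ b, ∀ r, b ≤ r → (c r).P = none → treatedLabel N ν (c r).toMarkedStage ≠ j by
        obtain ⟨b, hb⟩ := hB
        exact ⟨b, fun r hr hP ht => absurd ht (hb r hr hP)⟩
      by_contra hB
      push Not at hB
      obtain ⟨r₀, hr₀, hP₀, ht₀⟩ := hB m₀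
      -- the treated label is `j` from `r₀` on
      have htj : ∀ m, r₀ ≤ m → treatedLabel N ν (c m).toMarkedStage = j := by
        intro m hm
        obtain ⟨r', hr', -, ht'⟩ := hB m
        obtain ⟨d₁, rfl⟩ := Nat.exists_eq_add_of_le hm
        obtain ⟨d₂, rfl⟩ := Nat.exists_eq_add_of_le hr'
        exact le_antisymm (ht' ▸ hmono (r₀ + d₁) d₂) (ht₀ ▸ hmono r₀ d₁)
      -- hence every state from `r₀` on is between cycles and the policy speaks there
      have hall : ∀ d, (c (r₀ + d)).P = none ∧ SP (r₀ + d) := by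
        intro d
        induction d with
        | zero =>
          refine ⟨hP₀, (hdich r₀).resolve_right fun hFB => hex ⟨r₀, hr₀, hFB, ht₀⟩⟩
        | succ d ih =>
          have hP : (c (r₀ + (d + 1))).P = none := by rw [← add_assoc]; exact hSPnone _ ih.2
          exact ⟨hP, (hdich _).resolve_right fun hFB => hex ⟨r₀ + (d + 1), by omega, hFB, htj _ (by omega)⟩⟩
      -- but the chain moves: some late state is blown up, by a policy centre through `x_n` — excluded by (π-fin)
      obtain ⟨m, hm, hbu⟩ := hmov (r₀ + n₂)
      obtain ⟨d, rfl⟩ := Nat.exists_eq_add_of_le hm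
      rw [add_assoc] at hbu
      exact hSPmiss _ (by omega) (hall _).2 hbu
  choose b hb using hb
  -- past all the bounds of the old labels (and `m₀`), every between-cycle state treats a clean label
  refine ⟨(Finset.range ((c m₀).L.year + 1)).sup b + m₀, fun r hr hPr hcl y hy => ?_⟩
  have hclean : LabelCleanAt N ν (c r).toMarkedStage (treatedLabel N ν (c r).toMarkedStage) := by
    by_cases hjY : (c m₀).L.year < treatedLabel N ν (c r).toMarkedStage
    · obtain ⟨d, rfl⟩ := Nat.exists_eq_add_of_le (show m₀ ≤ r by omega)
      exact hnew d _ hjY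
    · have hle : b (treatedLabel N ν (c r).toMarkedStage) ≤ (Finset.range ((c m₀).L.year + 1)).sup b :=
        Finset.le_sup (Finset.mem_range.mpr (by omega))
      exact hb _ r (by omega) hPr rfl
  haveI : IsLocallyNoetherian (c r).W := (c r).ln
  haveI : IsNoetherian (c r).W := (hgd r).isNoetherian
  exact hclean.mem_regularLocus (hgd r).isClosed_hsStratum hcl y hy

/-! ## §3. E7's Low class for the menu hybrid from (b), (K-ctr), (π-fin), (c-menu) and the units half -/

/-- **E7's LOW CLASS AT A MAXIMAL ORIGIN FOR THE MENU HYBRID from (b)From, (K-ctr)From, (π-fin)From, (c-menu)From and the units half** — (c-reg) supplied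
by §2, (c-rep) by p537833, (c-swallow) by p535770; π, ω functional, policy steps emit `none` and are silent while a cycle is pending, ω names centres over
the non-regular locus of the part, the hybrid admissible on its run-wise scope. [cite: CossartJannsenSaito2020, Rem. 6.29 (1), Thm. 6.35, Thm. 6.40, p. 102, p. 107] -/
theorem low_init_hybrid_of_kernels (hK : LocalNearPointChainsTerminate.{u}) (hN0 : 0 < N) (hN3 : N ≤ 3)
    (hπ : π.IsFunctional N ν) (hω : OracleFunctionalΩE ω)
    (hπnone : ∀ (W : Scheme.{u}) (hW : IsLocallyNoetherian W) (L : Labelling W) (P : Option (Pending W)) (E : Boundary W)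
      (C : W.IdealSheafData) (P' : Option (Pending (blowup C))), π.step W hW N ν L P E C P' → P' = none)
    (hπgate : ∀ (W : Scheme.{u}) (hW : IsLocallyNoetherian W) (L : Labelling W) (P : Option (Pending W)) (E : Boundary W)
      (C : W.IdealSheafData) (P' : Option (Pending (blowup C))), π.step W hW N ν L P E C P' → P = none)
    (hωsing : ∀ (W : Scheme.{u}) (hW : IsLocallyNoetherian W) (N : ℕ) (ν : ℕ → ℕ) (L : Labelling W) (E : Boundary W) (S : Scheme.{u})
      (φ : S ⟶ W) (t : CentreSeq S), ω.namesE W hW N ν L E S φ t → t.CentresOver (Scheme.regularLocus S)ᶜ)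
    {p : ℕ} {E₀ : ∀ (X : Scheme.{u}), X → Boundary X}
    (hadm : IsAdmissibleStrategyOnE (StrategyE.RunReachableState p (π.hybrid (StrategyE.ofStageOracleE ω)) N ν E₀) N ν
      (π.hybrid (StrategyE.ofStageOracleE ω)))
    {X : Scheme.{u}} [IsLocallyNoetherian X] {x : X} (hX : IsMaximalOrigin p N ν X x)
    (hbirths : StrataBirthsSettleFromσE (π.hybrid (StrategyE.ofStageOracleE ω)) N ν (MarkedStageE.init X x (E₀ X x))
      fun s => s.geomDirDim < N)
    (hKctr : StrataCentreMembersCleanFromσE (π.hybrid (StrategyE.ofStageOracleE ω)) N ν (MarkedStageE.init X x (E₀ X x))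
      fun s => s.geomDirDim < N)
    (hfin : StrataPolicyMissesFromσE π (π.hybrid (StrategyE.ofStageOracleE ω)) N ν (MarkedStageE.init X x (E₀ X x))
      fun s => s.geomDirDim < N)
    (hmenu : StrataPolicySwallowFromσE π (π.hybrid (StrategyE.ofStageOracleE ω)) N ν (MarkedStageE.init X x (E₀ X x))
      fun s => s.geomDirDim < N)
    (hunits : NoMovingRecurrentNearChainFromσE (π.hybrid (StrategyE.ofStageOracleE ω)) N ν (MarkedStageE.init X x (E₀ X x))
      (fun s => s.geomDirDim < N) fun s => Iso N s) :
    ∀ e, e < N → NoMovingNearChainFromσE (π.hybrid (StrategyE.ofStageOracleE ω)) N ν (MarkedStageE.init X x (E₀ X x))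
      fun s => s.geomDirDim = e := by
  obtain ⟨k, hk, h0⟩ := RunGood.init hX
  have hperm : ∀ (W : Scheme.{u}) (hW : IsLocallyNoetherian W) (L : Labelling W) (P : Option (Pending W)) (E : Boundary W),
      StrategyE.RunReachableState p (π.hybrid (StrategyE.ofStageOracleE ω)) N ν E₀ W hW L P E →
        ∀ (C : W.IdealSheafData) (P' : Option (Pending (blowup C))),
          (π.hybrid (StrategyE.ofStageOracleE ω)).step W hW N ν L P E C P' → IdealSheafData.IsPermissible C :=
    fun W hW L P E hS C P' hst => ((hadm W hW L P E hS).1 C P' hst).1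
  have hscope : ∀ s : MarkedStageE.{u}, ReachesσE (π.hybrid (StrategyE.ofStageOracleE ω)) N ν (MarkedStageE.init X x (E₀ X x)) s →
      StrategyE.RunReachableState p (π.hybrid (StrategyE.ofStageOracleE ω)) N ν E₀ s.W s.ln s.L s.P s.E := fun s hs =>
    StrategyE.reachableState_subset_runReachableState (StrategyE.reachableState_of_inScopeMσE ⟨X, inferInstance, x, hX, hs⟩)
  have hgood : ∀ s : MarkedStageE.{u}, ReachesσE (π.hybrid (StrategyE.ofStageOracleE ω)) N ν (MarkedStageE.init X x (E₀ X x)) s →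
      RunGood k N ν s.W := fun s hs =>
    runGood_of_stateReachesσE (t := s.toStateσE) hX h0 hperm hs.stateReachesσE
  have hreg : StrataCycleStartRegularFromσE (π.hybrid (StrategyE.ofStageOracleE ω)) N ν (MarkedStageE.init X x (E₀ X x))
      fun s => s.geomDirDim < N :=
    strataCycleStartRegularFromσE_hybrid_of_clean hπ hω hπnone hπgate hgood
      (fun s hs C P' hst => hperm s.W s.ln s.L s.P s.E (hscope s hs) C P' hst) (labelInv_init X x) hX.mem_stratum hKctr hfin
  exact low_init_hybrid_of_rows_cycleStartRegular hK hN0 hN3 hπ hω hπnone hωsing hadm hX hbirths hreg hmenu hunits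

/-- **E7's `hlow` FOR THE MENU HYBRID AT `Q`-ORIGINS FROM (b), (K-ctr), (π-fin), (c-menu) AND THE UNITS HALF** (level `3`, every `ν`): the shape res-D-pv-047's
`rowsAtσE_of_globalRows` consumes, with (c-rep)/(c-reg) supplied. [cite: CossartJannsenSaito2020, Rem. 6.29 (1), Thm. 6.35, Thm. 6.40, p. 102, p. 107] -/
theorem maxOriginNoMovingNearChainAtQσE_low_hybrid_of_kernels {p : ℕ} {Q : ℕ → (ℕ → ℕ) → ∀ X : Scheme.{u}, X → Prop}
    {E₀ : ∀ X : Scheme.{u}, Boundary X}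
    (hK : LocalNearPointChainsTerminate.{u}) (hπ : ∀ ν, π.IsFunctional 3 ν) (hω : OracleFunctionalΩE ω)
    (hπnone : ∀ (ν : ℕ → ℕ) (W : Scheme.{u}) (hW : IsLocallyNoetherian W) (L : Labelling W) (P : Option (Pending W)) (E : Boundary W)
      (C : W.IdealSheafData) (P' : Option (Pending (blowup C))), π.step W hW 3 ν L P E C P' → P' = none)
    (hπgate : ∀ (ν : ℕ → ℕ) (W : Scheme.{u}) (hW : IsLocallyNoetherian W) (L : Labelling W) (P : Option (Pending W)) (E : Boundary W)
      (C : W.IdealSheafData) (P' : Option (Pending (blowup C))), π.step W hW 3 ν L P E C P' → P = none)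
    (hωsing : ∀ (W : Scheme.{u}) (hW : IsLocallyNoetherian W) (N : ℕ) (ν : ℕ → ℕ) (L : Labelling W) (E : Boundary W) (S : Scheme.{u})
      (φ : S ⟶ W) (t : CentreSeq S), ω.namesE W hW N ν L E S φ t → t.CentresOver (Scheme.regularLocus S)ᶜ)
    (hadm : ∀ ν, IsAdmissibleStrategyOnE
      (StrategyE.RunReachableState p (π.hybrid (StrategyE.ofStageOracleE ω)) 3 ν fun X _ => E₀ X) 3 ν
      (π.hybrid (StrategyE.ofStageOracleE ω)))
    (hbirths : ∀ (ν : ℕ → ℕ) (X : Scheme.{u}) [IsLocallyNoetherian X] (x : X), IsMaximalOrigin p 3 ν X x → Q 3 ν X x →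
      StrataBirthsSettleFromσE (π.hybrid (StrategyE.ofStageOracleE ω)) 3 ν (MarkedStageE.init X x (E₀ X)) fun s => s.geomDirDim < 3)
    (hKctr : ∀ (ν : ℕ → ℕ) (X : Scheme.{u}) [IsLocallyNoetherian X] (x : X), IsMaximalOrigin p 3 ν X x → Q 3 ν X x →
      StrataCentreMembersCleanFromσE (π.hybrid (StrategyE.ofStageOracleE ω)) 3 ν (MarkedStageE.init X x (E₀ X)) fun s => s.geomDirDim < 3)
    (hfin : ∀ (ν : ℕ → ℕ) (X : Scheme.{u}) [IsLocallyNoetherian X] (x : X), IsMaximalOrigin p 3 ν X x → Q 3 ν X x →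
      StrataPolicyMissesFromσE π (π.hybrid (StrategyE.ofStageOracleE ω)) 3 ν (MarkedStageE.init X x (E₀ X)) fun s => s.geomDirDim < 3)
    (hmenu : ∀ (ν : ℕ → ℕ) (X : Scheme.{u}) [IsLocallyNoetherian X] (x : X), IsMaximalOrigin p 3 ν X x → Q 3 ν X x →
      StrataPolicySwallowFromσE π (π.hybrid (StrategyE.ofStageOracleE ω)) 3 ν (MarkedStageE.init X x (E₀ X))
        fun s => s.geomDirDim < 3)
    (hunits : MaxOriginNoMovingRecurrentNearChainAtQσE (π.hybrid (StrategyE.ofStageOracleE ω)) p 3 Q (fun X _ => E₀ X)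
      (fun s => s.geomDirDim < 3) fun s => Iso 3 s) :
    ∀ e, e ≤ 2 → MaxOriginNoMovingNearChainAtQσE (π.hybrid (StrategyE.ofStageOracleE ω)) p 3 Q (fun X _ => E₀ X)
      fun s => s.geomDirDim = e := by
  refine maxOriginNoMovingNearChainAtQσE_low_hybrid_of_rows hK hπ hω hadm hbirths (fun ν X _ x hX hQ => ?_) hmenu hunits
  obtain ⟨k, hk, h0⟩ := RunGood.init hX
  have hperm : ∀ (W : Scheme.{u}) (hW : IsLocallyNoetherian W) (L : Labelling W) (P : Option (Pending W)) (E : Boundary W),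
      StrategyE.RunReachableState p (π.hybrid (StrategyE.ofStageOracleE ω)) 3 ν (fun X _ => E₀ X) W hW L P E →
        ∀ (C : W.IdealSheafData) (P' : Option (Pending (blowup C))),
          (π.hybrid (StrategyE.ofStageOracleE ω)).step W hW 3 ν L P E C P' → IdealSheafData.IsPermissible C :=
    fun W hW L P E hS C P' hst => ((hadm ν W hW L P E hS).1 C P' hst).1
  have hscope : ∀ s : MarkedStageE.{u}, ReachesσE (π.hybrid (StrategyE.ofStageOracleE ω)) 3 ν (MarkedStageE.init X x (E₀ X)) s →
      StrategyE.RunReachableState p (π.hybrid (StrategyE.ofStageOracleE ω)) 3 ν (fun X _ => E₀ X) s.W s.ln s.L s.P s.E := fun s hs =>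
    StrategyE.reachableState_subset_runReachableState
      (StrategyE.reachableState_of_inScopeMσE (E₀ := fun X _ => E₀ X) ⟨X, inferInstance, x, hX, hs⟩)
  have hgood : ∀ s : MarkedStageE.{u}, ReachesσE (π.hybrid (StrategyE.ofStageOracleE ω)) 3 ν (MarkedStageE.init X x (E₀ X)) s →
      RunGood k 3 ν s.W := fun s hs =>
    runGood_of_stateReachesσE (E₀ := fun X _ => E₀ X) (t := s.toStateσE) hX h0 hperm hs.stateReachesσE
  exact strataReplaySettleFromσE_hybrid_of_cycleStartRegular (hπ ν) hω (hπnone ν) hωsing hgood hX.mem_stratum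
    (strataCycleStartRegularFromσE_hybrid_of_clean (hπ ν) hω (hπnone ν) (hπgate ν) hgood
      (fun s hs C P' hst => hperm s.W s.ln s.L s.P s.E (hscope s hs) C P' hst) (labelInv_init X x) hX.mem_stratum
      (hKctr ν X x hX hQ) (hfin ν X x hX hQ))

end Summit.ResolutionOfSingularities.ResolutionOfSingularities.Theorems.SigmaMaxModificationsCorridor3.Sigma

end
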